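import Mathlib
import Literature.Claims.NS.Kyritsis2017
import HarnessLib

/-!
# Solo salvage for claim C03c `Kyritsis2017` (cell `ns-claims`, D-0090), part 2: the typed `Step_5`
# (PROP 5.1, 2nd proof, p. 315 — «conservation of particles ⇒ bounded velocity gradient») kernel-discharged,
# hence the WHOLE printed conditional Proposition 5.2 (Euler and Navier–Stokes) proved outright

Claim skeleton: `Literature/Claims/NS/Kyritsis2017.lean` (typist `ns-claims-typist-3`, p463635): Prop. 5.2
p. 315 = regularity UNDER THE ADDED HYPOTHESIS «conservation of particles as local structure» (Def. 5.1
p. 314), typed as `ClaimedTheorem` (`ν ≥ 0`: Euler and Navier–Stokes), with `claim_of_step5 : Step_5 →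
ClaimedTheorem` already in the skeleton (Step_5 + PROP 4.8 = Beale–Kato–Majda continuation, `step2_holds`).
Part 1 (`SoloSalvageKyritsis2017.lean`, seat `ns-claims-salvage-p3`, p465554) proved the Navier–Stokes half
`claimedTheoremNS_holds` through the `L^∞`-velocity criterion.

This file (referee seat `ns-claims-ref-2`, charitable re-typing R#3′ of `claims/Kyritsis2017/RETYPE.md`)
discharges `Step_5` for EVERY `ν ≥ 0` without any dissipation: Definition 5.1 (2)+(3) gives, on each
particle range `ball c r` at time `t` (trajectories start at the identity, `IsTrajectoryMap.init`),
`‖u(t,y) − u(t,c)‖ ≤ δu` and `‖∇u(t,y) − ∇u(t,c)‖ ≤ δω`; the mean-value inequality applied to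
`y ↦ u(t,y) − ∇u(t,c)(y − c)` gives `‖∇u(t,c) z‖ ≤ δu + δω‖z‖` for `‖z‖ < r`, hence
`‖∇u(t,c)‖ ≤ δu/r + δω` (`opNorm_fderiv_center_le`) and `‖∇u(t,x)‖ ≤ δu/r + 2δω` for every `x`
(`opNorm_fderiv_le_of_range`, the ranges cover the space). Consequences:

* `step5_holds : Step_5` — the printed conclusion of PROP 5.1 (2nd proof) is TRUE for `ν ≥ 0`; the printed
  argument's use of the dissipation density (void at `ν = 0`) is an erratum of the PROOF, not of the statement.
* `claimedTheorem_holds : ClaimedTheorem` — the printed conditional Prop. 5.2 holds outright (both halves);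
  the adjudication of C03c is by TYPE only (the hypothesis `ConservationOfParticles u T` is a condition on the
  solution, not a Clay (A) datum condition).

Solo lane (`Theorems/SoloSalvage<Slug>…lean`, no item).

WHAT THIS IS NOT: not a claim about NS regularity or blow-up; not a claim about any author beyond the
typed locator.
-/

set_option linter.dupNamespace false

namespace Summit.NavierStokesRegularity.NavierStokesRegularity.Theorems.Kyritsis2017Salvage


open Metric Set
open scoped ContDiff
open Literature.Analysis.FluidPDE
open Literature.Claims.NS.Kyritsis2021 (IsLocalClassSolution)

variable {E F : Type*} [NormedAddCommGroup E] [NormedSpace ℝ E] [NormedAddCommGroup F] [NormedSpace ℝ F]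

/-- An operator bounded by `a + b‖z‖` on the ball of radius `r` has norm `≤ a / r + b`. -/
theorem opNorm_le_of_affine_bound_on_ball (L : E →L[ℝ] F) (r a b : ℝ) (hr : 0 < r) (ha : 0 ≤ a)
    (hb : 0 ≤ b) (h : ∀ z : E, ‖z‖ < r → ‖L z‖ ≤ a + b * ‖z‖) : ‖L‖ ≤ a / r + b := by
  refine le_of_forall_pos_le_add fun ε hε => ?_
  obtain ⟨k, hk1, hkε⟩ : ∃ k : ℝ, 1 < k ∧ (k - 1) * a / r ≤ ε := by
    have hpos : 0 < a + 1 := by linarith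
    have hq : 0 < ε * r / (a + 1) := by positivity
    refine ⟨1 + ε * r / (a + 1), by linarith, ?_⟩
    rw [show (1 + ε * r / (a + 1) - 1) = ε * r / (a + 1) by ring, div_le_iff₀ hr]
    rw [div_mul_eq_mul_div, div_le_iff₀ hpos]
    nlinarith
  have hkpos : 0 < k := by linarith
  have hC : 0 ≤ k * a / r + b := by positivity
  have : ‖L‖ ≤ k * a / r + b := by
    have hkabs : 1 < ‖(k : ℝ)‖ := by rw [Real.norm_eq_abs, abs_of_pos hkpos]; exact hk1
    refine ContinuousLinearMap.opNorm_le_of_shell (c := (k : ℝ)) hr hC hkabs ?_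
    intro z hz1 hz2
    have hz : ‖z‖ < r := hz2
    have hbound := h z hz
    have hkz : r / ‖(k : ℝ)‖ ≤ ‖z‖ := hz1
    rw [Real.norm_eq_abs, abs_of_pos hkpos] at hkz
    have h1 : a ≤ k * a / r * ‖z‖ := by
      have : r ≤ k * ‖z‖ := by
        rw [div_le_iff₀ hkpos] at hkz; linarith
      calc a = a * r / r := by field_simp
        _ ≤ a * (k * ‖z‖) / r := by gcongr
        _ = k * a / r * ‖z‖ := by ring
    calc ‖L z‖ ≤ a + b * ‖z‖ := hbound
      _ ≤ k * a / r * ‖z‖ + b * ‖z‖ := by linarith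
      _ = (k * a / r + b) * ‖z‖ := by ring
  calc ‖L‖ ≤ k * a / r + b := this
    _ = a / r + b + (k - 1) * a / r := by ring
    _ ≤ a / r + b + ε := by linarith

/-- Mean-value estimate at the centre of a particle range. -/
theorem opNorm_fderiv_center_le (u : E → F) (c : E) (r δu δω : ℝ) (hr : 0 < r) (hδu : 0 ≤ δu)
    (hδω : 0 ≤ δω) (hdiff : ∀ y ∈ ball c r, DifferentiableAt ℝ u y)
    (hu : ∀ y ∈ ball c r, ‖u y - u c‖ ≤ δu)
    (hD : ∀ y ∈ ball c r, ‖fderiv ℝ u y - fderiv ℝ u c‖ ≤ δω) :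
    ‖fderiv ℝ u c‖ ≤ δu / r + δω := by
  set L : E →L[ℝ] F := fderiv ℝ u c with hL
  let g : E → F := fun y => u y - L (y - c)
  have hg : ∀ y ∈ ball c r, ‖g y - g c‖ ≤ δω * ‖y - c‖ := by
    intro y hy
    have hconv : Convex ℝ (ball c r) := convex_ball c r
    have hgdiff : ∀ z ∈ ball c r, DifferentiableAt ℝ g z := by
      intro z hz
      exact ((hdiff z hz).sub ((L.differentiableAt).comp z (differentiableAt_id.sub_const c)))
    have hgbound : ∀ z ∈ ball c r, ‖fderiv ℝ g z‖ ≤ δω := by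
      intro z hz
      have h1 : HasFDerivAt (fun y : E => y - c) (ContinuousLinearMap.id ℝ E) z :=
        (hasFDerivAt_id z).sub_const c
      have h2 : HasFDerivAt (fun y : E => L (y - c)) (L.comp (ContinuousLinearMap.id ℝ E)) z :=
        L.hasFDerivAt.comp z h1
      have h3 : HasFDerivAt g (fderiv ℝ u z - L.comp (ContinuousLinearMap.id ℝ E)) z :=
        (hdiff z hz).hasFDerivAt.sub h2
      rw [h3.fderiv, ContinuousLinearMap.comp_id]
      exact hD z hz
    exact hconv.norm_image_sub_le_of_norm_fderiv_le hgdiff hgbound (mem_ball_self hr) hy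
  have hmain : ∀ z : E, ‖z‖ < r → ‖L z‖ ≤ δu + δω * ‖z‖ := by
    intro z hz
    have hy : c + z ∈ ball c r := by
      rw [mem_ball, dist_eq_norm]; simpa using hz
    have h1 := hg (c + z) hy
    have h2 := hu (c + z) hy
    have hgc : g c = u c := by simp [g]
    have hgy : g (c + z) = u (c + z) - L z := by simp [g]
    rw [hgy, hgc] at h1
    have hsimp : ‖c + z - c‖ = ‖z‖ := by simp
    rw [hsimp] at h1
    calc ‖L z‖ = ‖(u (c + z) - u c) - (u (c + z) - L z - u c)‖ := by congr 1; abel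
      _ ≤ ‖u (c + z) - u c‖ + ‖u (c + z) - L z - u c‖ := norm_sub_le _ _
      _ ≤ δu + δω * ‖z‖ := by linarith
  exact opNorm_le_of_affine_bound_on_ball L r δu δω hr hδu hδω hmain

/-- The bound at every point of a particle range. -/
theorem opNorm_fderiv_le_of_range (u : E → F) (c : E) (r δu δω : ℝ) (hr : 0 < r) (hδu : 0 ≤ δu)
    (hδω : 0 ≤ δω) (hdiff : ∀ y ∈ ball c r, DifferentiableAt ℝ u y)
    (hu : ∀ y ∈ ball c r, ‖u y - u c‖ ≤ δu)
    (hD : ∀ y ∈ ball c r, ‖fderiv ℝ u y - fderiv ℝ u c‖ ≤ δω) (x : E) (hx : x ∈ ball c r) :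
    ‖fderiv ℝ u x‖ ≤ δu / r + 2 * δω := by
  have h1 := opNorm_fderiv_center_le u c r δu δω hr hδu hδω hdiff hu hD
  have h2 := hD x hx
  calc ‖fderiv ℝ u x‖ = ‖(fderiv ℝ u x - fderiv ℝ u c) + fderiv ℝ u c‖ := by congr 1; abel
    _ ≤ ‖fderiv ℝ u x - fderiv ℝ u c‖ + ‖fderiv ℝ u c‖ := norm_add_le _ _
    _ ≤ δω + (δu / r + δω) := by linarith
    _ = δu / r + 2 * δω := by ring

/-- **The typed `Step_5` of C03c holds** (Definition 5.1 (2)+(3) at `s = t` ⇒ `‖∇u(t,x)‖ ≤ δu/r + 2δω`). -/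
theorem step5_holds : Literature.Claims.NS.Kyritsis2017.Step_5 := by
  intro ν hν T hT u p hsol hcpt hcons
  obtain ⟨X, hX, r, hr, δx, _, δu, hδu, δω, hδω, hcov⟩ := hcons
  refine ⟨δu / r + 2 * δω, fun t ht x => ?_⟩
  obtain ⟨𝒞, hcover, hballs⟩ := hcov t ht
  obtain ⟨c, hc, hx⟩ := hcover x
  have hsmooth : ContDiff ℝ ∞ (u t) := hsol.1.contDiff_velocity ht
  have hdiff : ∀ y ∈ ball c r, DifferentiableAt ℝ (u t) y := fun y _ =>
    hsmooth.differentiable (by simp) y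
  have hcc : c ∈ ball c r := mem_ball_self hr
  have htt : t ∈ Ico t T := ⟨le_rfl, ht.2⟩
  have hu : ∀ y ∈ ball c r, ‖u t y - u t c‖ ≤ δu := by
    intro y hy
    have h := (hballs c hc y hy c hcc t htt).2.1
    rwa [hX.init t ht y, hX.init t ht c] at h
  have hD : ∀ y ∈ ball c r, ‖fderiv ℝ (u t) y - fderiv ℝ (u t) c‖ ≤ δω := by
    intro y hy
    have h := (hballs c hc y hy c hcc t htt).2.2.1
    rwa [hX.init t ht y, hX.init t ht c] at h
  exact opNorm_fderiv_le_of_range (u t) c r δu δω hr hδu.le hδω.le hdiff hu hD x hx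

/-- The printed conditional statement (Prop 5.2 p. 315 as typed) is a theorem. -/
theorem claimedTheorem_holds : Literature.Claims.NS.Kyritsis2017.ClaimedTheorem :=
  Literature.Claims.NS.Kyritsis2017.claim_of_step5 step5_holds

end Summit.NavierStokesRegularity.NavierStokesRegularity.Theorems.Kyritsis2017Salvage
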